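import Literature.Geometry.Lorentzian.CoordBianchi
import Mathlib.LinearAlgebra.QuadraticForm.Basic
import Mathlib.Analysis.Calculus.Deriv.Inv
import HarnessLib

/-!
# The divergence of a vector field in coordinates, the Bochner-type identity
# `div(∇_Z Z) − ∂_Z(div Z) = Ric(Z,Z) + tr((∇Z)²)`, and the curvature of a surface as a divergence

A further layer of the coordinate tensor calculus of metric components
`G : E → (E →L E →L ℝ)` smooth, symmetric and nondegenerate on an open set `V`
(`MetricCoord.IsMetricOn`, `CoordCurvature.lean`: Christoffel map `chrAt`, curvature `riemAt`,
Ricci form `ricAt`, scalar curvature `scalAt`). Everything here is PROVED; the file introduces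
the two explicit definitions `covDAt` and `divAt` and no statement of `Prop` type.

* `covDAt G Z x : E →L E` — the covariant differential `X ↦ ∇_X Z = DZ(x)X + Γ_x(Z x, X)` of a
  vector field `Z : E → E` (O'Neill 1983, Ch. 3, Prop. 3.13 (1)–(2); it is the coordinate form of
  the Levi-Civita connection, `OpensChart.leviCivita_apply_eq` with `christoffel_eq_chrAt`), and
  `divAt G Z x = tr (covDAt G Z x)` — the divergence (O'Neill 1983, Ch. 3, p. 86); Leibniz rules
  `covDAt_smul`, `divAt_smul`, `covDAt_sub`;
* `IsMetricOn.hasFDerivAt_covDAt_self`, `hasFDerivAt_divAt`, `hasFDerivAt_apply_self` — the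
  derivatives of `y ↦ ∇_Z Z`, `y ↦ div Z` and `y ↦ G(Z, Z)` (`∂_X G(Z,Z) = 2 G(∇_X Z, Z)`);
* `IsMetricOn.divAt_covDAt_self_sub` — the **Bochner-type identity**
  `div(∇_Z Z)(x) − ∂_{Z x}(div Z) = Ric(Z x, Z x) + tr((∇Z|_x)²)`, the trace of the Ricci
  identity `∇²_{X,Y}Z − ∇²_{Y,X}Z = R(X,Y)Z` (O'Neill 1983, Ch. 3, Prop. 3.37 ff.; the vector-field
  form of the computation behind Bochner's formula, Petersen, *Riemannian Geometry*, 3rd ed.,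
  §9.2): the second derivatives of `Z` cancel by symmetry, the Christoffel terms by the symmetry
  of `Γ` and `DΓ` (torsion-freeness), the last pair by `tr(PQ) = tr(QP)`;
* dimension two: `traceCLM_comp_self_sub_sq` (`tr A² − (tr A)² = −2 det A`),
  `comp_self_sub_trace_smul_add_det_smul` (Cayley–Hamilton), `IsMetricOn.exists_isOrthoᵢ_basis`,
  and `IsMetricOn.ricAt_eq_of_finrank_eq_two` — **`Ric = (S/2) G` on a surface** (Lee 2018,
  Cor. 8.28), computed in a `G x`-orthogonal basis;
* `IsMetricOn.divAt_normalized` — **the Gauss curvature of a surface is a divergence**: for a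
  smooth vector field `Z` with `G_x(Z, Z) ≠ 0` on a `2`-dimensional space,
  `div( (∇_Z Z − (div Z) Z) / G(Z,Z) )(x) = S(x)/2 = K(x)`.
  (For the unit field `V = Z/|Z|` the field inside is `∇_V V − (div V) V`; this is Cartan's
  structure equation `dω₁₂ = −K θ¹ ∧ θ²` written without a coframe or an orientation.)

Purpose: `divAt_normalized` is the local identity of the Poincaré–Hopf route to the
Gauss–Bonnet theorem for compact surfaces (integrate `K = div(…)` away from the zeros of a
vector field with the divergence theorem `integral_vectorDivergence_eq_zero`,
`DivergenceTheorem.lean`), the remaining input `geroch_monotonicity_smooth_of_gaussBonnet`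
(`IMCFMeanCurvatureEvolution.lean`) of Huisken–Ilmanen's Geroch monotonicity.

## References

* B. O'Neill, *Semi-Riemannian geometry with applications to relativity*, Academic Press 1983,
  Ch. 3: Prop. 3.13 (coordinate formula for `D`), p. 86 (divergence), Prop. 3.36–3.37,
  Lemma 3.38 (curvature in coordinates), Lemma 3.52 (Ricci). [ONeill1983]
* J. M. Lee, *Introduction to Riemannian Manifolds*, 2nd ed., Springer 2018, Cor. 8.28
  (`Rc = K g`, `S = 2K` on a `2`-manifold), Problem 5-14 (`div X = tr ∇X`).
  [LeeRiemannianManifolds2018]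
* P. Petersen, *Riemannian Geometry*, 3rd ed., GTM 171, Springer 2016, §9.2 (Bochner technique).
-/

noncomputable section

open Set Filter ContinuousLinearMap Module
open scoped Topology ContDiff

namespace Literature.Geometry.Lorentzian

namespace MetricCoord

variable {E : Type*} [NormedAddCommGroup E] [NormedSpace ℝ E]

section Defs

variable (G : E → E →L[ℝ] E →L[ℝ] ℝ)

/-- The **covariant differential in coordinates** of a vector field `Z : E → E` at `x`:
`∇Z|_x : X ↦ ∇_X Z = DZ(x) X + Γ_x(Z(x), X)` (O'Neill 1983, Ch. 3, Prop. 3.13 (1)–(2):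
`D_V W = ∑_k (V W^k + Γ^k_{ij} V^i W^j) ∂_k`; on `V` the Christoffel map is symmetric, so this is
also `DZ(x) X + Γ_x(X, Z(x))`, `covDAt_apply_eq`). [cite: ONeill1983, Ch. 3, Prop. 3.13] -/
def covDAt (Z : E → E) (x : E) : E →L[ℝ] E :=
  fderiv ℝ Z x + chrAt G x (Z x)

/-- Unfolding lemma: `∇_X Z = DZ(x) X + Γ_x(Z x, X)`. [folklore] -/
theorem covDAt_apply (Z : E → E) (x X : E) :
    covDAt G Z x X = fderiv ℝ Z x X + chrAt G x (Z x) X := rfl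

variable [FiniteDimensional ℝ E]

/-- The **divergence in coordinates** of a vector field `Z : E → E` at `x`: `div Z = tr ∇Z|_x`
(O'Neill 1983, Ch. 3, p. 86; Lee 2018, Problem 5-14). [cite: ONeill1983, Ch. 3, p. 86] -/
def divAt (Z : E → E) (x : E) : ℝ :=
  traceCLM E (covDAt G Z x)

/-- Unfolding lemma for `divAt`. [folklore] -/
theorem divAt_eq (Z : E → E) (x : E) : divAt G Z x = traceCLM E (covDAt G Z x) := rfl

end Defs

variable [FiniteDimensional ℝ E] [CompleteSpace E] {G : E → E →L[ℝ] E →L[ℝ] ℝ} {V : Set E}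
  {x : E} {Z : E → E}

omit [FiniteDimensional ℝ E] [CompleteSpace E] in
/-- On `V`, `∇_X Z = DZ(x) X + Γ_x(X, Z x)` as well (symmetry of the Christoffel map).
[cite: ONeill1983, Ch. 3, Prop. 3.13] -/
theorem IsMetricOn.covDAt_apply_eq (hG : IsMetricOn G V) (hx : x ∈ V) (Z : E → E) (X : E) :
    covDAt G Z x X = fderiv ℝ Z x X + chrAt G x X (Z x) := by
  rw [covDAt_apply, hG.chrAt_comm hx]

omit [FiniteDimensional ℝ E] [CompleteSpace E] in
/-- **Leibniz rule for the covariant differential**: `∇(ψ Z)|_x = ψ(x) ∇Z|_x + dψ_x ⊗ Z(x)`.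
[cite: ONeill1983, Ch. 3, Def. 3.9–3.10] -/
theorem covDAt_smul {ψ : E → ℝ} (hψ : DifferentiableAt ℝ ψ x) (hZ : DifferentiableAt ℝ Z x) :
    covDAt G (fun y ↦ ψ y • Z y) x = ψ x • covDAt G Z x + (fderiv ℝ ψ x).smulRight (Z x) := by
  ext X
  simp only [covDAt_apply, fderiv_fun_smul hψ hZ, _root_.add_apply, FunLike.coe_smul,
    Pi.smul_apply, ContinuousLinearMap.smulRight_apply, map_smul, smul_add]
  abel

omit [CompleteSpace E] in
/-- **Leibniz rule for the divergence**: `div(ψ Z)(x) = ψ(x) div Z(x) + dψ_x(Z x)`.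
O'Neill 1983, Ch. 3, p. 86. [cite: ONeill1983, Ch. 3, p. 86] -/
theorem divAt_smul {ψ : E → ℝ} (hψ : DifferentiableAt ℝ ψ x) (hZ : DifferentiableAt ℝ Z x) :
    divAt G (fun y ↦ ψ y • Z y) x = ψ x * divAt G Z x + fderiv ℝ ψ x (Z x) := by
  rw [divAt_eq, covDAt_smul hψ hZ, map_add, map_smul, smul_eq_mul, divAt_eq, traceCLM_apply,
    traceCLM_apply]
  congr 1
  have h : (((fderiv ℝ ψ x).smulRight (Z x) : E →L[ℝ] E) : E →ₗ[ℝ] E) =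
      ((fderiv ℝ ψ x : E →L[ℝ] ℝ) : E →ₗ[ℝ] ℝ).smulRight (Z x) := LinearMap.ext fun v ↦ rfl
  rw [h, LinearMap.trace_smulRight]
  rfl

/-! ### Derivatives of `∇_Z Z` and of `div Z` -/

omit [FiniteDimensional ℝ E] in
/-- **Derivative of `y ↦ ∇_{Z} Z (y)`** in coordinates: with `A = DZ(x)`, `z = Z(x)`,
`Γ = Γ_x`, `D(∇_Z Z)(x) = A ∘ A + D²Z(x)(·, z) + Γ(z) ∘ A + (Γ ∘ A + DΓ(x)(·)(z))ᵀ_z`, where the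
last map is `X ↦ Γ(A X, z) + D_XΓ(z, z)`. [folklore] -/
theorem IsMetricOn.hasFDerivAt_covDAt_self (hG : IsMetricOn G V) (hx : x ∈ V)
    (hZ : ContDiffOn ℝ ∞ Z V) :
    HasFDerivAt (fun y ↦ covDAt G Z y (Z y))
      ((fderiv ℝ Z x).comp (fderiv ℝ Z x) + (fderiv ℝ (fderiv ℝ Z) x).flip (Z x) +
        (chrAt G x (Z x)).comp (fderiv ℝ Z x) +
        ((chrAt G x).comp (fderiv ℝ Z x) + (fderiv ℝ (chrAt G) x).flip (Z x)).flip (Z x)) x := by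
  have hZx : ContDiffAt ℝ ∞ Z x := (hZ x hx).contDiffAt (hG.mem_nhds hx)
  have hZd : DifferentiableAt ℝ Z x := hZx.differentiableAt (by simp)
  have hDZ : DifferentiableAt ℝ (fderiv ℝ Z) x :=
    ((hZx.fderiv_right (m := ∞) (by norm_num)).differentiableAt (by simp))
  have hΓ := hG.differentiableAt_chrAt hx
  -- `y ↦ DZ(y)(Z y)`
  have h1 : HasFDerivAt (fun y ↦ fderiv ℝ Z y (Z y))
      ((fderiv ℝ Z x).comp (fderiv ℝ Z x) + (fderiv ℝ (fderiv ℝ Z) x).flip (Z x)) x :=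
    hDZ.hasFDerivAt.clm_apply hZd.hasFDerivAt
  -- `y ↦ Γ_y(Z y)`
  have h2 : HasFDerivAt (fun y ↦ chrAt G y (Z y))
      ((chrAt G x).comp (fderiv ℝ Z x) + (fderiv ℝ (chrAt G) x).flip (Z x)) x :=
    hΓ.hasFDerivAt.clm_apply hZd.hasFDerivAt
  -- `y ↦ Γ_y(Z y)(Z y)`
  have h3 : HasFDerivAt (fun y ↦ chrAt G y (Z y) (Z y))
      ((chrAt G x (Z x)).comp (fderiv ℝ Z x) +
        ((chrAt G x).comp (fderiv ℝ Z x) + (fderiv ℝ (chrAt G) x).flip (Z x)).flip (Z x)) x :=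
    h2.clm_apply hZd.hasFDerivAt
  have key : HasFDerivAt (fun y ↦ covDAt G Z y (Z y))
      (((fderiv ℝ Z x).comp (fderiv ℝ Z x) + (fderiv ℝ (fderiv ℝ Z) x).flip (Z x)) +
        ((chrAt G x (Z x)).comp (fderiv ℝ Z x) +
          ((chrAt G x).comp (fderiv ℝ Z x) + (fderiv ℝ (chrAt G) x).flip (Z x)).flip (Z x))) x :=
    h1.add h3
  convert key using 1
  abel

/-- **Derivative of the divergence** in coordinates: `D(div Z)(x) = tr ∘ (D²Z(x) + Γ ∘ DZ(x)
+ DΓ(x)(·)(Z x))`. [folklore] -/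
theorem IsMetricOn.hasFDerivAt_divAt (hG : IsMetricOn G V) (hx : x ∈ V)
    (hZ : ContDiffOn ℝ ∞ Z V) :
    HasFDerivAt (divAt G Z)
      ((traceCLM E).comp (fderiv ℝ (fderiv ℝ Z) x +
        ((chrAt G x).comp (fderiv ℝ Z x) + (fderiv ℝ (chrAt G) x).flip (Z x)))) x := by
  have hZx : ContDiffAt ℝ ∞ Z x := (hZ x hx).contDiffAt (hG.mem_nhds hx)
  have hZd : DifferentiableAt ℝ Z x := hZx.differentiableAt (by simp)
  have hDZ : DifferentiableAt ℝ (fderiv ℝ Z) x :=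
    ((hZx.fderiv_right (m := ∞) (by norm_num)).differentiableAt (by simp))
  have h2 : HasFDerivAt (fun y ↦ chrAt G y (Z y))
      ((chrAt G x).comp (fderiv ℝ Z x) + (fderiv ℝ (chrAt G) x).flip (Z x)) x :=
    (hG.differentiableAt_chrAt hx).hasFDerivAt.clm_apply hZd.hasFDerivAt
  have hcov : HasFDerivAt (fun y ↦ covDAt G Z y) (fderiv ℝ (fderiv ℝ Z) x +
      ((chrAt G x).comp (fderiv ℝ Z x) + (fderiv ℝ (chrAt G) x).flip (Z x))) x :=
    hDZ.hasFDerivAt.add h2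
  exact (traceCLM E).hasFDerivAt.comp x hcov

omit [FiniteDimensional ℝ E] [CompleteSpace E] in
/-- **The Ricci endomorphism in coordinates**: `X ↦ R(X, z) z` is
`X ↦ D_XΓ(z,z) − D_zΓ(X,z) + Γ(X, Γ(z,z)) − Γ(z, Γ(X,z))`. [cite: ONeill1983, Ch. 3, Lemma 3.38] -/
theorem ricciEndo_eq (x z : E) :
    ricciEndo G x z z = ((((fderiv ℝ (chrAt G) x).flip z).flip z - (fderiv ℝ (chrAt G) x z).flip z +
      (chrAt G x).flip (chrAt G x z z) - (chrAt G x z).comp ((chrAt G x).flip z) :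
        E →L[ℝ] E) : E →ₗ[ℝ] E) := by
  refine LinearMap.ext fun X ↦ ?_
  simp only [ricciEndo_apply, riemAt_apply, ContinuousLinearMap.coe_coe, _root_.sub_apply,
    _root_.add_apply, flip_apply, ContinuousLinearMap.comp_apply]

/-- **Bochner-type identity for a vector field** (the trace of the Ricci identity
`∇²_{X,Y} Z − ∇²_{Y,X} Z = R(X,Y) Z`; O'Neill 1983, Ch. 3, Prop. 3.37 ff.; Petersen,
*Riemannian Geometry*, the Bochner formula): for a smooth vector field `Z` on `V`,
`div(∇_Z Z)(x) − ∂_{Z(x)}(div Z)(x) = Ric(Z, Z)(x) + tr((∇Z|_x)²)`.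
Proof: expand both sides in `DZ`, `D²Z`, `Γ`, `DΓ`; the second derivatives cancel by symmetry
of `D²Z`, the Christoffel terms by the symmetry of `Γ` and of `DΓ`, and the remaining pair by
`tr(PQ) = tr(QP)`. [cite: ONeill1983, Ch. 3, Prop. 3.37] -/
theorem IsMetricOn.divAt_covDAt_self_sub (hG : IsMetricOn G V) (hx : x ∈ V)
    (hZ : ContDiffOn ℝ ∞ Z V) :
    divAt G (fun y ↦ covDAt G Z y (Z y)) x - fderiv ℝ (divAt G Z) x (Z x) =
      ricAt G x (Z x) (Z x) + traceCLM E ((covDAt G Z x).comp (covDAt G Z x)) := by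
  have hZx : ContDiffAt ℝ ∞ Z x := (hZ x hx).contDiffAt (hG.mem_nhds hx)
  -- abbreviations
  set A : E →L[ℝ] E := fderiv ℝ Z x with hA
  set A2 : E →L[ℝ] E →L[ℝ] E := fderiv ℝ (fderiv ℝ Z) x with hA2
  set Γ : E →L[ℝ] E →L[ℝ] E := chrAt G x with hΓ
  set DΓ : E →L[ℝ] E →L[ℝ] E →L[ℝ] E := fderiv ℝ (chrAt G) x with hDΓ
  set z : E := Z x with hz
  -- the two derivatives
  rw [divAt_eq, covDAt, (hG.hasFDerivAt_covDAt_self hx hZ).fderiv,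
    (hG.hasFDerivAt_divAt hx hZ).fderiv, ricAt_apply, ricciEndo_eq, ← traceCLM_apply]
  simp only [← hA, ← hA2, ← hΓ, ← hDΓ, ← hz, covDAt]
  -- symmetry inputs
  have hsymm2 : A2.flip z = A2 z := by
    ext X
    simp only [flip_apply, hA2]
    exact hZx.isSymmSndFDerivAt two_le_infty X z
  have hΓc : ∀ X Y : E, Γ X Y = Γ Y X := fun X Y ↦ hG.chrAt_comm hx X Y
  have hDΓc : ∀ v X Y : E, DΓ v X Y = DΓ v Y X := fun v X Y ↦ hG.fderiv_chrAt_comm hx v X Y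
  have e2 : (Γ.comp A).flip z = (Γ z).comp A := by
    ext X
    simp only [flip_apply, ContinuousLinearMap.comp_apply, hΓc (A X) z]
  have e4 : Γ.flip (Γ z z) = Γ (Γ z z) := by
    ext X
    simp only [flip_apply, hΓc]
  have e5 : (Γ z).comp (Γ.flip z) = (Γ z).comp (Γ z) := by
    ext X
    simp only [ContinuousLinearMap.comp_apply, flip_apply, hΓc X z]
  have e6 : (DΓ z).flip z = DΓ z z := by
    ext X
    simp only [flip_apply, hDΓc z X z]
  have htr : traceCLM E ((Γ z).comp A) = traceCLM E (A.comp (Γ z)) := traceCLM_comp_comm _ _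
  -- expand and compare
  simp only [ContinuousLinearMap.flip_add, e2, e4, e5, e6, map_add, map_sub, _root_.add_apply,
    ContinuousLinearMap.comp_apply, flip_apply, hsymm2, ContinuousLinearMap.add_comp,
    ContinuousLinearMap.comp_add]
  linarith [htr]

/-! ### Linear algebra in dimension two -/

section DimTwo

omit [CompleteSpace E]

/-- In dimension two, `tr(A²) − (tr A)² = −2 det A`. [folklore] -/
theorem traceCLM_comp_self_sub_sq (h2 : finrank ℝ E = 2) (A : E →L[ℝ] E) :
    traceCLM E (A.comp A) - (traceCLM E A) ^ 2 = -2 * LinearMap.det (A : E →ₗ[ℝ] E) := by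
  set b := Module.finBasisOfFinrankEq ℝ E h2 with hb
  set M : Matrix (Fin 2) (Fin 2) ℝ := LinearMap.toMatrix b b (A : E →ₗ[ℝ] E) with hM
  have htr : traceCLM E A = M.trace := by
    rw [traceCLM_apply, hM, LinearMap.trace_eq_matrix_trace ℝ b]
  have htr2 : traceCLM E (A.comp A) = (M * M).trace := by
    rw [traceCLM_apply, ContinuousLinearMap.toLinearMap_comp, LinearMap.trace_eq_matrix_trace ℝ b,
      LinearMap.toMatrix_comp b b b, hM]
  have hdet : LinearMap.det (A : E →ₗ[ℝ] E) = M.det := by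
    rw [hM, LinearMap.det_toMatrix]
  rw [htr, htr2, hdet, Matrix.trace_fin_two, Matrix.trace_fin_two, Matrix.det_fin_two,
    Matrix.mul_apply, Matrix.mul_apply, Fin.sum_univ_two, Fin.sum_univ_two]
  ring

/-- **Cayley–Hamilton in dimension two**: `A² − (tr A) A + (det A) 1 = 0`. [folklore] -/
theorem comp_self_sub_trace_smul_add_det_smul (h2 : finrank ℝ E = 2) (A : E →L[ℝ] E) :
    A.comp A - (traceCLM E A) • A + (LinearMap.det (A : E →ₗ[ℝ] E)) • (1 : E →L[ℝ] E) = 0 := by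
  set b := Module.finBasisOfFinrankEq ℝ E h2 with hb
  set M : Matrix (Fin 2) (Fin 2) ℝ := LinearMap.toMatrix b b (A : E →ₗ[ℝ] E) with hM
  have htr : traceCLM E A = M.trace := by
    rw [traceCLM_apply, hM, LinearMap.trace_eq_matrix_trace ℝ b]
  have hdet : LinearMap.det (A : E →ₗ[ℝ] E) = M.det := by
    rw [hM, LinearMap.det_toMatrix]
  -- pass to matrices
  have key : LinearMap.toMatrix b b ((A.comp A - (traceCLM E A) • A +
      (LinearMap.det (A : E →ₗ[ℝ] E)) • (1 : E →L[ℝ] E) : E →L[ℝ] E) : E →ₗ[ℝ] E) = 0 := by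
    rw [ContinuousLinearMap.toLinearMap_add, ContinuousLinearMap.toLinearMap_sub,
      ContinuousLinearMap.toLinearMap_smul, ContinuousLinearMap.toLinearMap_smul,
      ContinuousLinearMap.toLinearMap_comp, map_add, map_sub, map_smul, map_smul,
      LinearMap.toMatrix_comp b b b, ContinuousLinearMap.toLinearMap_one, LinearMap.toMatrix_one,
      ← hM, htr, hdet, Matrix.trace_fin_two, Matrix.det_fin_two]
    ext i j
    fin_cases i <;> fin_cases j <;>
      simp [Matrix.mul_apply, Fin.sum_univ_two] <;> ring
  have := congrArg (Matrix.toLin b b) key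
  rwa [Matrix.toLin_toMatrix, map_zero, ← ContinuousLinearMap.toLinearMap_zero,
    ContinuousLinearMap.coe_inj] at this

/-- Consequence of Cayley–Hamilton in dimension two: for a bilinear form `B` and a vector `z`,
`B((A² − (tr A) A) z, z) = −det A · B(z, z)`. [folklore] -/
theorem apply_comp_self_sub (h2 : finrank ℝ E = 2) (A : E →L[ℝ] E) (B : E →L[ℝ] E →L[ℝ] ℝ)
    (z : E) : B (A (A z) - traceCLM E A • A z) z = -LinearMap.det (A : E →ₗ[ℝ] E) * B z z := by
  have h := comp_self_sub_trace_smul_add_det_smul h2 A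
  have hz : (A.comp A - (traceCLM E A) • A + (LinearMap.det (A : E →ₗ[ℝ] E)) •
      (1 : E →L[ℝ] E)) z = 0 := by rw [h]; rfl
  simp only [_root_.add_apply, _root_.sub_apply, ContinuousLinearMap.comp_apply,
    _root_.smul_apply, one_apply_eq_self] at hz
  have hz' : A (A z) - traceCLM E A • A z = -(LinearMap.det (A : E →ₗ[ℝ] E) • z) := by
    rw [eq_neg_iff_add_eq_zero, hz]
  rw [hz', map_neg, map_smul, _root_.neg_apply, _root_.smul_apply, smul_eq_mul, neg_mul]

/-- Every `G x`, `x ∈ V`, admits a `G x`-orthogonal basis of non-null vectors, indexed by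
`Fin (dim E)` (Mathlib's `LinearMap.BilinForm.exists_orthogonal_basis`; nondegeneracy from the
invertibility of `G x`). [folklore] -/
theorem IsMetricOn.exists_isOrthoᵢ_basis [CompleteSpace E] (hG : IsMetricOn G V) (hx : x ∈ V) :
    ∃ e : Basis (Fin (finrank ℝ E)) ℝ E,
      (∀ i j, i ≠ j → G x (e i) (e j) = 0) ∧ ∀ i, G x (e i) (e i) ≠ 0 := by
  set B : LinearMap.BilinForm ℝ E := (ContinuousLinearMap.coeLM ℝ).comp (G x).toLinearMap
    with hB
  have hBapply : ∀ v w, B v w = G x v w := fun v w ↦ rfl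
  have hsymm : B.IsSymm := ⟨fun v w ↦ by rw [RingHom.id_apply, hBapply, hBapply]; exact hG.symm x hx _ _⟩
  obtain ⟨e, he⟩ := LinearMap.BilinForm.exists_orthogonal_basis hsymm
  have hsep : B.SeparatingLeft := by
    intro v hv
    have h0 : G x v = 0 := by
      ext w
      exact hv w
    have := (hG.isInvertible x hx).injective
    exact this (by rw [h0, map_zero])
  refine ⟨e, fun i j hij ↦ ?_, fun i ↦ ?_⟩
  · have := he hij
    exact this
  · have := he.not_isOrtho_basis_self_of_separatingLeft hsep i
    exact this

omit [FiniteDimensional ℝ E] in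
/-- `G(R(X,Y)W, W) = 0` (skew-adjointness of the curvature endomorphism).
[cite: ONeill1983, Ch. 3, Prop. 3.36 (2)] -/
theorem IsMetricOn.apply_riemAt_self [CompleteSpace E] (hG : IsMetricOn G V) (hx : x ∈ V)
    (X Y W : E) : G x (riemAt G x X Y W) W = 0 := by
  have h := hG.apply_riemAt_swap hx X Y W W
  linarith

/-- **In dimension two the Ricci tensor is `(S/2) g`** (Lee 2018, Cor. 8.28, `Rc = K g`,
`S = 2K`; O'Neill 1983, Ch. 3, Cor. 3.42 ff.): for the components `G` of a metric on a
`2`-dimensional space, `Ric_x(Y, Z) = (S(x)/2) G_x(Y, Z)` at every `x ∈ V`. Proof in a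
`G x`-orthogonal basis `(b₀, b₁)`: with `K = G(R(b₀,b₁)b₁, b₀)` one has `Ric(b₀,b₀) = K/G(b₁,b₁)`,
`Ric(b₁,b₁) = K/G(b₀,b₀)`, `Ric(b₀,b₁) = 0`, `S = 2K/(G(b₀,b₀)G(b₁,b₁))`.
[cite: LeeRiemannianManifolds2018, Cor. 8.28] -/
theorem IsMetricOn.ricAt_eq_of_finrank_eq_two [CompleteSpace E] (hG : IsMetricOn G V) (hx : x ∈ V)
    (h2 : finrank ℝ E = 2) (Y Z : E) :
    ricAt G x Y Z = scalAt G x / 2 * G x Y Z := by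
  classical
  obtain ⟨e, he, hc⟩ := hG.exists_isOrthoᵢ_basis hx
  set b : Basis (Fin 2) ℝ E := e.reindex (finCongr h2) with hb
  have hbe : ∀ i, b i = e ((finCongr h2).symm i) := fun i ↦ by simp [hb]
  have hort : ∀ i j : Fin 2, i ≠ j → G x (b i) (b j) = 0 := fun i j hij ↦ by
    rw [hbe, hbe]
    exact he _ _ fun h ↦ hij (by simpa using h)
  have hnn : ∀ i : Fin 2, G x (b i) (b i) ≠ 0 := fun i ↦ by rw [hbe]; exact hc _
  have hi := hG.isInvertible x hx
  have h01 : G x (b 0) (b 1) = 0 := hort 0 1 (by decide)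
  have h10 : G x (b 1) (b 0) = 0 := hort 1 0 (by decide)
  set g0 := G x (b 0) (b 0) with hg0
  set g1 := G x (b 1) (b 1) with hg1
  have hg0' : g0 ≠ 0 := hnn 0
  have hg1' : g1 ≠ 0 := hnn 1
  -- coordinates in the orthogonal basis
  have hcoord : ∀ (i : Fin 2) (v : E), b.coord i v = G x v (b i) / G x (b i) (b i) := by
    intro i v
    rw [eq_div_iff (hnn i)]
    conv_rhs => rw [← b.sum_repr v]
    simp only [Fin.sum_univ_two, Basis.coord_apply]
    fin_cases i
    · simp [h10]
    · simp [h01]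
  -- the Ricci tensor and the scalar curvature in the basis
  set K := G x (riemAt G x (b 0) (b 1) (b 1)) (b 0) with hK
  have hRic : ∀ Y Z, ricAt G x Y Z = G x (riemAt G x (b 0) Y Z) (b 0) / g0 +
      G x (riemAt G x (b 1) Y Z) (b 1) / g1 := fun Y Z ↦ by
    rw [ricAt_eq_sum_coord b, Fin.sum_univ_two, hcoord, hcoord]
  have hScal : scalAt G x = ricAt G x (b 0) (b 0) / g0 + ricAt G x (b 1) (b 1) / g1 := by
    rw [scalAt, mtrAt, trace_eq_sum_coord b, Fin.sum_univ_two, hcoord, hcoord]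
    simp only [ContinuousLinearMap.coe_coe, ContinuousLinearMap.comp_apply,
      apply_sharpAt_apply hi, hg0, hg1]
  have hv1 : G x (riemAt G x (b 1) (b 0) (b 0)) (b 1) = K := by
    rw [riemAt_swap, _root_.neg_apply, map_neg, _root_.neg_apply,
      hG.apply_riemAt_swap hx (b 0) (b 1) (b 1) (b 0), neg_neg]
  have hz : ∀ w : E, G x (0 : E) w = 0 := fun w ↦ by
    rw [(G x).map_zero]; rfl
  have hR00 : ricAt G x (b 0) (b 0) = K / g1 := by
    rw [hRic, riemAt_self, hv1, _root_.zero_apply, hz, zero_div, zero_add]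
  have hR11 : ricAt G x (b 1) (b 1) = K / g0 := by
    rw [hRic, riemAt_self, _root_.zero_apply, hz, zero_div, add_zero]
  have hR01 : ricAt G x (b 0) (b 1) = 0 := by
    rw [hRic, riemAt_self, _root_.zero_apply, hz, zero_div, zero_add, hG.apply_riemAt_self hx,
      zero_div]
  have hR10 : ricAt G x (b 1) (b 0) = 0 := by
    rw [hRic, hG.apply_riemAt_self hx, zero_div, zero_add, riemAt_self, _root_.zero_apply, hz,
      zero_div]
  have hS : scalAt G x = 2 * K / (g0 * g1) := by
    rw [hScal, hR00, hR11]
    field_simp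
    ring
  -- the identity on basis vectors
  have key : ∀ j k : Fin 2, ricAt G x (b j) (b k) = scalAt G x / 2 * G x (b j) (b k) := by
    intro j k
    fin_cases j <;> fin_cases k
    · simp only [Fin.zero_eta, hR00, hS, ← hg0]
      field_simp
    · simp only [Fin.zero_eta, Fin.mk_one, hR01, h01, mul_zero]
    · simp only [Fin.zero_eta, Fin.mk_one, hR10, h10, mul_zero]
    · simp only [Fin.mk_one, hR11, hS, ← hg1]
      field_simp
  -- bilinear extension
  conv_lhs => rw [← b.sum_repr Y, ← b.sum_repr Z]
  conv_rhs => rw [← b.sum_repr Y, ← b.sum_repr Z]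
  simp only [map_sum, map_smul, FunLike.coe_sum, Finset.sum_apply, _root_.smul_apply,
    smul_eq_mul, key, Finset.mul_sum]
  refine Finset.sum_congr rfl fun j _ ↦ Finset.sum_congr rfl fun k _ ↦ ?_
  ring

end DimTwo

/-! ### The surface identity `div((∇_Z Z − (div Z) Z)/|Z|²) = S/2` -/

section Surface

omit [FiniteDimensional ℝ E] [CompleteSpace E] in
/-- `∇(W − U) = ∇W − ∇U` for fields differentiable at the point. [folklore] -/
theorem covDAt_sub {W U : E → E} (hW : DifferentiableAt ℝ W x) (hU : DifferentiableAt ℝ U x) :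
    covDAt G (fun y ↦ W y - U y) x = covDAt G W x - covDAt G U x := by
  simp only [covDAt, fderiv_fun_sub hW hU, map_sub]
  abel

omit [FiniteDimensional ℝ E] [CompleteSpace E] in
/-- **Derivative of `|Z|²_G`**: `∂_X G(Z,Z) = 2 G(∇_X Z, Z)` (metric compatibility).
[cite: ONeill1983, Ch. 3, Prop. 3.13] -/
theorem IsMetricOn.hasFDerivAt_apply_self (hG : IsMetricOn G V) (hx : x ∈ V)
    (hZ : DifferentiableAt ℝ Z x) :
    HasFDerivAt (fun y ↦ G y (Z y) (Z y))
      ((2 : ℝ) • ((G x).flip (Z x)).comp (covDAt G Z x)) x := by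
  have h1 : HasFDerivAt (fun y ↦ G y (Z y))
      ((G x).comp (fderiv ℝ Z x) + (fderiv ℝ G x).flip (Z x)) x :=
    (hG.differentiableAt hx).hasFDerivAt.clm_apply hZ.hasFDerivAt
  have h2 : HasFDerivAt (fun y ↦ G y (Z y) (Z y))
      ((G x (Z x)).comp (fderiv ℝ Z x) +
        ((G x).comp (fderiv ℝ Z x) + (fderiv ℝ G x).flip (Z x)).flip (Z x)) x :=
    h1.clm_apply hZ.hasFDerivAt
  refine h2.congr_fderiv ?_
  ext X
  simp only [_root_.add_apply, ContinuousLinearMap.comp_apply, flip_apply, _root_.smul_apply,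
    smul_eq_mul, covDAt_apply, map_add, hG.fderiv_eq_chrAt hx X (Z x) (Z x),
    hG.symm x hx (Z x) (fderiv ℝ Z x X), hG.symm x hx (Z x) (chrAt G x X (Z x)),
    hG.chrAt_comm hx (Z x) X]
  ring

/-- **The curvature of a surface as a divergence.** For the components `G` of a metric on a
`2`-dimensional space, `x ∈ V`, and a smooth vector field `Z` on `V` with `G_x(Z,Z) ≠ 0`:
`div( (∇_Z Z − (div Z) Z) / G(Z,Z) )(x) = S(x)/2` — i.e. the Gauss curvature `K = S/2` is the
divergence of the field `∇_V V − (div V) V` of the unit field `V = Z/|Z|` (the structure equation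
`dω₁₂ = −K θ¹ ∧ θ²` in vector form, Lee 2018, Cor. 8.28 for `Ric = K g`). Proof: Leibniz,
the Bochner-type identity `divAt_covDAt_self_sub`, `Ric = (S/2) G` in dimension two,
`tr(A²) − (tr A)² = −2 det A` and Cayley–Hamilton for `A = ∇Z|_x`, and
`∂_X G(Z,Z) = 2G(∇_X Z, Z)`. [cite: ONeill1983, Ch. 3, Prop. 3.37] -/
theorem IsMetricOn.divAt_normalized (hG : IsMetricOn G V) (hx : x ∈ V) (h2 : finrank ℝ E = 2)
    (hZ : ContDiffOn ℝ ∞ Z V) (hz : G x (Z x) (Z x) ≠ 0) :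
    divAt G (fun y ↦ (G y (Z y) (Z y))⁻¹ • (covDAt G Z y (Z y) - divAt G Z y • Z y)) x =
      scalAt G x / 2 := by
  have hZx : ContDiffAt ℝ ∞ Z x := (hZ x hx).contDiffAt (hG.mem_nhds hx)
  have hZd : DifferentiableAt ℝ Z x := hZx.differentiableAt (by simp)
  -- abbreviations
  set A : E →L[ℝ] E := covDAt G Z x with hA
  set z : E := Z x with hzdef
  set q : ℝ := G x z z with hq
  -- derivatives of the pieces
  have hW := hG.hasFDerivAt_covDAt_self hx hZ
  have hdiv := hG.hasFDerivAt_divAt hx hZ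
  have hWd : DifferentiableAt ℝ (fun y ↦ covDAt G Z y (Z y)) x := hW.differentiableAt
  have hdivd : DifferentiableAt ℝ (divAt G Z) x := hdiv.differentiableAt
  have hUd : DifferentiableAt ℝ (fun y ↦ divAt G Z y • Z y) x := hdivd.smul hZd
  have hW₂d : DifferentiableAt ℝ (fun y ↦ covDAt G Z y (Z y) - divAt G Z y • Z y) x :=
    hWd.sub hUd
  have hqD := hG.hasFDerivAt_apply_self hx hZd
  have hψ : HasFDerivAt (fun y ↦ (G y (Z y) (Z y))⁻¹)
      ((ContinuousLinearMap.smulRight (1 : ℝ →L[ℝ] ℝ) (-(q ^ 2)⁻¹)).comp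
        ((2 : ℝ) • ((G x).flip z).comp A)) x :=
    (hasFDerivAt_inv hz).comp x hqD
  have hψd : DifferentiableAt ℝ (fun y ↦ (G y (Z y) (Z y))⁻¹) x := hψ.differentiableAt
  -- the divergence of `W₂ = ∇_Z Z − (div Z) Z`
  have hdivW₂ : divAt G (fun y ↦ covDAt G Z y (Z y) - divAt G Z y • Z y) x =
      ricAt G x z z + traceCLM E (A.comp A) - (traceCLM E A) ^ 2 := by
    have hstar := hG.divAt_covDAt_self_sub hx hZ
    rw [divAt_eq, covDAt_sub hWd hUd, map_sub, ← divAt_eq, ← divAt_eq, divAt_smul hdivd hZd]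
    rw [← divAt_eq, sq]
    linarith [hstar]
  -- assemble
  rw [divAt_smul hψd hW₂d, hψ.fderiv, hdivW₂, hG.ricAt_eq_of_finrank_eq_two hx h2]
  have htr := traceCLM_comp_self_sub_sq h2 A
  have hCH := apply_comp_self_sub h2 A (G x) z
  simp only [map_sub, map_smul, _root_.sub_apply, _root_.smul_apply, smul_eq_mul] at hCH
  simp only [_root_.smul_apply, ContinuousLinearMap.comp_apply, flip_apply, smul_eq_mul, map_sub,
    map_smul, ContinuousLinearMap.smulRight_apply, one_apply_eq_self]
  have hdv : divAt G Z x = traceCLM E A := rfl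
  rw [hdv]
  simp only [← hzdef, ← hq]
  set d := LinearMap.det (A : E →ₗ[ℝ] E) with hd
  have e1 : G x (A (A z)) z = traceCLM E A * G x (A z) z - d * q := by linarith [hCH]
  have e2 : traceCLM E (A.comp A) = traceCLM E A ^ 2 - 2 * d := by linarith [htr]
  rw [e1, e2]
  field_simp
  ring

end Surface



end MetricCoord

end Literature.Geometry.Lorentzian

end
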